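import Literature.Analysis.OperatorTheory.Enflo2023.StepRealisationDiagNFloor
import HarnessLib

/-!
# Enflo (2023), Part B at the TEXT'S OWN MODULUS: for `σ ≤ ‖T‖/4` (∋ `σ = δ₂ = (‖T‖/2)²`) the orbit tree of the
realised Main Construction in the type-1 model `T_τ = diag(τ, τ/2)` is INFINITE — an explicit scheduled run
"to arbitrarily small `(εθ)`'s" converging to a non-cyclic vector (`StepRealisation.Diag`, low-modulus regime)

WHAT THIS FILE DECIDES.

1. REGIME BOOKKEEPING (general `H`).  A type-1 constant at level `n` — `δ‖y‖² ≤ |⟨Tʲy, y⟩|` for some `j ≥ n`, for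
   every `y` of the angle cone `Referee.AngleCond u₀` (v2 p.6; p.19 l.656–660: `j₂ > n₀`) — satisfies `δ ≤ ‖T‖ⁿ`, so
   `δ₂ ≤ ‖T‖²` once `j₂ ≥ 2` and `‖T‖ ≤ 1` (`type1Const_le_opNorm_pow`, `type1Const_le_opNorm_sq`; the text has
   `‖T‖ = 10⁻²⁰`, v2 p.1).  With the record's dictionary `σ = δ₂` (the modulus of the two-fold independence (34) along
   the type-1 branch) the text's modulus therefore satisfies `σ ≤ ‖T‖²`, whereas EVERY finite-tree calibration of the
   record — `Toy`/`Diag`/`DiagN.not_indepRunD`, `DiagN.reachD_etheta_floor`, `DiagN.no_scheduled_run` — carries the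
   hypothesis `τ = ‖T‖ ≤ σ/100` (or stronger).  `not_calibrationRegime_of_modulus_le_sq`: the two regimes are disjoint.

2. THE COMPLEMENTARY REGIME, DECIDED for `d = 2`.  `Diag.exists_scheduled_run` (and, in the types of
   `DiagN.no_scheduled_run`, `DiagN.exists_scheduled_run_two`): for `T_τ = diag(τ, τ/2)` on `ℂ²`, `0 < τ ≤ 1/100`,
   modulus `0 < σ ≤ τ/4` and ratio `0 < β ≤ σ²/1000` there are an admissible CYCLIC start `s₀` at the unit vector
   `x₀ = (4/5, 3/5)` — a true MC state over the shift with `(εθ)₀ > 0`, the start margin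
   `0.09 + (22/σ+1)(εθ)₀ ≤ ε₀² ≤ 0.49 − (22/σ+1)(εθ)₀`, both eigen-coordinates of `y₀` non-zero — and states `s_n` of
   the orbit tree `ReachD (ιS S) σ β s₀` (steps `V ↦ V̂(1 + N)`, `N ∈ {S}'`, `‖N‖ ≤ 2β/σ`, ratio EXACTLY `1 − β`, drifts
   (45) and `|Δε²| ≤ (22/σ+1)β(εθ)`) with `(εθ)_{s_n} = (1−β)ⁿ(εθ)₀` for EVERY `n`.  This is the literal negation of
   the conclusion of `DiagN.no_scheduled_run` (`d = 2`, `w = (τ, τ/2)`) with its hypothesis `τ ≤ σ/100` replaced by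
   `σ ≤ τ/4`; `Diag.exists_scheduled_run_at_type1Const` is the instance `σ = (τ/2)² = δ₂`, the model's own type-1
   constant at `j₂ = 2` (`Diag.type1`).  So the depth of the orbit tree in the SAME model is finite for `‖T‖ ≤ σ/100`
   and infinite for `σ ≤ ‖T‖/4`.

3. THE MECHANISM (why the modulus decides it).  An explicit one-parameter family of EXACT brackets
   (`Diag.isBracket_K`: `z + WW†z = x₀`), indexed by the residual eigen-coordinate `κ` of the run vector
   `y(κ) = (M(κ), κ)`, `M(κ) = 4(1+s)/(3κG₀₁)`, `s = κ²G₁₁`: MC vector `z(κ) = ζ(κ)u₁`, `ε(κ) = ζ(κ) = 0.6/(1+s)`,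
   `(εθ)(κ) = ζ²s` (`stK_ε`, `stK_etheta`).  The step `κ → tκ` with `t(1+s) = √(1−β)(1+t²s)` (`exists_root`, IVT)
   multiplies `(εθ)` by exactly `1 − β` (`step_ratio`) and is the commutant reshaping `V_{y(tκ)} = W(1 + φ₀ + φ₁S)`
   (`WK_comp`: the kernels `g_w` are eigenvectors of `S†`), whose two multipliers `A = (1−β)^{-1/2} − 1` (big
   coordinate) and `B = t − 1` (residual coordinate) are `O(β)` (`step_arith`); interpolating them by a degree-one
   polynomial at the nodes `τ`, `τ/2` costs `‖N‖ ≤ |φ₀| + |φ₁| ≤ 7.03β + 6.02β/τ ≤ 8β/τ`, which is `≤ 2β/σ` iff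
   (up to constants) `σ ≤ τ/4` (`φc_norm`).  In the calibrated regime `τ ≤ σ/100` the same reshaping would need
   `‖N‖ ≈ 8β/τ ≥ 800β/σ`, 400 times the admissible size — the quantitative content of the dichotomy: separating two
   eigen-coordinates at spectral distance `τ/2` by an admissible commutant step needs `β/σ ≳ β/τ`, i.e. `σ ≲ ‖T‖`.
   The drifts are tiny (`drift_arith`: `|Δε²|, |Re⟨x₀, Δv⟩| ≤ 23β(εθ)`, against the budget `(22/σ+1)β(εθ)`).

4. THE ENDGAME SHAPE.  Along the run `x₀ − v_n → (4/5)u₀` (`fK_tendsto`) and `T_τu₀ = τu₀` (`TD_u_zero`): the moved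
   parts converge to a NON-CYCLIC vector and `x₀ − lim = (3/5)u₁ ⊥ orbit(u₀)` — the text's conclusion (p.19
   l.677–683: "y_n converge to a non-cyclic vector") realised inside `ℂ²`, where of course every operator has
   invariant subspaces.

READING for the repair record (calibration, not a claim about the text's theorem).  (i) It CORRECTS the scope
sentence of `StepRealisationDiag` ("for `σ < 8τ` — a modulus below the operator norm, outside the text's standing
regime — nothing is claimed"): by item 1 the text's standing regime is `σ = δ₂ ≤ ‖T‖² < 8‖T‖`; the finite-tree
theorems R28–R31 are statements about a LARGE modulus `σ ≥ 100‖T‖` only.  (ii) At the text's modulus the same model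
carries an infinite scheduled orbit with exactly the behaviour p.19 l.666–683 describes, so the finite-dimensional
calibrations are neither evidence against the inference p.19 l.656–661 ⟹ l.666–677 nor evidence for it: the run here
is produced by an explicit formula, not by the two-fold independence (34), and nothing in this file speaks about
`IndepAtκ` / the kernel residual `IndepRunD` (which quantifies (34) itself at every tree state).  (iii) STATUS of the
located gap is unchanged: the unproved inference of Part B remains v2 p.19 l.656–661 (type 1, `δ₂`, `n₀` independent of
`(εθ)`) ⟹ l.666–677 ("`δ₂`-linearly independent … to arbitrarily small `(εθ)`'s"), typed as
`StepRealisation.IndepRunD`; what this file adds is that its "(εθ) → 0 along admissible steps" half is CONSISTENT in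
the type-1 model at `σ = δ₂`, and that the finiteness obstruction of `StepRealisationDiagN(Floor)` is a large-modulus
artefact.  Nothing is claimed for `τ/4 < σ < 100τ`, for `d ≥ 3`, or for infinite-dimensional `H`.

No new axioms (closure of `DiagN.exists_scheduled_run_two`: `propext`, `Classical.choice`, `Quot.sound`); zero
`sorry`; the model API (`gv`, `wt`, `u`, `TD`, `cf`, `G`, `K_apply`, `G_bounds`, `xD`, `apply_coord`, `inner_gv_S`,
`TDg_wt`, …) is imported from `StepRealisationDiag` / `StepRealisationDiagN` by name.
-/

noncomputable section

open scoped InnerProductSpace ComplexConjugate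
open ContinuousLinearMap Filter Topology

namespace Literature.Analysis.OperatorTheory.Enflo2023

namespace StepRealisation

open MCStep Vy
open Lemma1.Standing (e e_apply norm_e inner_e_left)

/-! ### A. Regime bookkeeping: a type-1 constant at level `n` is at most `‖T‖ⁿ` -/

section regime

variable {H : Type*} [NormedAddCommGroup H] [InnerProductSpace ℂ H]

omit [InnerProductSpace ℂ H] in
/-- `‖Tʲy‖ ≤ ‖T‖ʲ‖y‖` for iterates. [folklore] -/
lemma norm_iterate_apply_le [NormedSpace ℂ H] (T : H →L[ℂ] H) (j : ℕ) (y : H) :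
    ‖(⇑T)^[j] y‖ ≤ ‖T‖ ^ j * ‖y‖ := by
  induction j with
  | zero => simp
  | succ j ih =>
    rw [Function.iterate_succ_apply', pow_succ]
    calc ‖T ((⇑T)^[j] y)‖ ≤ ‖T‖ * ‖(⇑T)^[j] y‖ := T.le_opNorm _
      _ ≤ ‖T‖ * (‖T‖ ^ j * ‖y‖) := by gcongr
      _ = ‖T‖ ^ j * ‖T‖ * ‖y‖ := by ring

/-- **A type-1 constant at level `n` is at most `‖T‖ⁿ`** (`‖T‖ ≤ 1`): the defining inequality of type 1
(v2 p.6: every `y` at angle `≥ 1/100` to `u₀` has some `j ≥ n` with `|⟨Tʲy, y⟩| ≥ δ_n‖y‖²`), tested at `y = u₀`,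
gives `δ_n ≤ ‖T‖ʲ ≤ ‖T‖ⁿ`.  With `‖T‖ = 10⁻²⁰` (v2 p.1) and `j₂ > n₀ ≥ 1` (p.19 l.656–660): `δ₂ ≤ ‖T‖²`.
[cite: Enflo2023, v2 p.6 (type 1); p.19 l.656–660] -/
theorem type1Const_le_opNorm_pow {T : H →L[ℂ] H} {u0 : H} (hu : ‖u0‖ = 1) (hT : ‖T‖ ≤ 1) {n : ℕ} {δ : ℝ}
    (hy : ∀ y : H, Referee.AngleCond u0 y → ∃ j : ℕ, n ≤ j ∧ δ * ‖y‖ ^ 2 ≤ ‖⟪(⇑T)^[j] y, y⟫_ℂ‖) :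
    δ ≤ ‖T‖ ^ n := by
  have hu0 : u0 ≠ 0 := by
    rw [← norm_ne_zero_iff, hu]; norm_num
  have hre : (⟪u0, u0⟫_ℂ).re = 1 := by
    rw [inner_self_eq_norm_sq_to_K, hu]; simp
  have hac : Referee.AngleCond u0 u0 := ⟨hu0, by rw [hre, hu]; norm_num⟩
  obtain ⟨j, hj, hδ⟩ := hy u0 hac
  have h1 : ‖⟪(⇑T)^[j] u0, u0⟫_ℂ‖ ≤ ‖T‖ ^ j := by
    calc ‖⟪(⇑T)^[j] u0, u0⟫_ℂ‖ ≤ ‖(⇑T)^[j] u0‖ * ‖u0‖ := norm_inner_le_norm _ _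
      _ ≤ ‖T‖ ^ j * ‖u0‖ * ‖u0‖ := by gcongr; exact norm_iterate_apply_le T j u0
      _ = ‖T‖ ^ j := by rw [hu]; ring
  have h2 : ‖T‖ ^ j ≤ ‖T‖ ^ n := pow_le_pow_of_le_one (norm_nonneg _) hT hj
  rw [hu] at hδ
  linarith

/-- … so for `j₂ ≥ 2` (p.19: `j₂ > n₀ ≥ j₁ ≥ 1`) the constant is `≤ ‖T‖²`. [cite: Enflo2023, v2 p.19 l.656–660] -/
theorem type1Const_le_opNorm_sq {T : H →L[ℂ] H} {u0 : H} (hu : ‖u0‖ = 1) (hT : ‖T‖ ≤ 1) {n : ℕ} (hn : 2 ≤ n)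
    {δ : ℝ} (hy : ∀ y : H, Referee.AngleCond u0 y → ∃ j : ℕ, n ≤ j ∧ δ * ‖y‖ ^ 2 ≤ ‖⟪(⇑T)^[j] y, y⟫_ℂ‖) :
    δ ≤ ‖T‖ ^ 2 :=
  (type1Const_le_opNorm_pow hu hT hy).trans (pow_le_pow_of_le_one (norm_nonneg _) hT hn)

/-- **The two regimes do not meet.**  A modulus `σ ≤ δ ≤ t²` (`t = ‖T‖ ≤ 1`, `t > 0`) is never in the
calibrations' regime `t ≤ σ/32` (`StepRealisationDiag`/`DiagN`/`DiagNFloor` assume `‖T‖ ≤ σ/100`, their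
closure needs `‖T‖ < σ/32`). Pure arithmetic. [cite: Enflo2023, v2 p.1 (`‖T‖ = 10⁻²⁰`), p.19 l.656–660] -/
theorem not_calibrationRegime_of_modulus_le_sq {t δ σ : ℝ} (ht0 : 0 < t) (ht1 : t ≤ 1) (hδ : δ ≤ t ^ 2)
    (hσ : σ ≤ δ) : ¬ t ≤ σ / 32 := by
  intro h
  nlinarith

end regime

namespace Diag

/-! ### B. The explicit bracket family through the residual direction `u₁` (`d = 2`, `T_τ = diag(τ, τ/2)`,
`x₀ = (4/5, 3/5)`): run vectors `y(κ) = (M(κ), κ)`, MC vectors `z(κ) = ζ(κ)·u₁` -/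

section family

variable {τ : ℝ}

/-- `s(κ) := κ²G₁₁` (`= (εθ)/ε²` of the family's state at `κ`). [folklore] -/
def sK (τ κ : ℝ) : ℝ := κ * κ * G τ 1 1

/-- `ζ(κ) := (3/5)/(1 + s(κ))` (the radius of the family's state at `κ`). [folklore] -/
def ζK (τ κ : ℝ) : ℝ := 3 / 5 / (1 + sK τ κ)

/-- `M(κ) := (4/5)/(ζ(κ)κG₀₁)`, the big coordinate of the run vector, designed so that `(V_yV_y†z)₀ = 4/5`.
[folklore] -/
def MK (τ κ : ℝ) : ℝ := 4 / 5 / (ζK τ κ * κ * G τ 0 1)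

/-- THE RUN VECTORS `y(κ) = (M(κ), κ)` of the family. [cite: Enflo2023, v2 (2) p.2] -/
def yK (τ κ : ℝ) : C2 := ((MK τ κ : ℝ) : ℂ) • u 0 + ((κ : ℝ) : ℂ) • u 1

/-- `y(κ)₀ = M(κ)`. [folklore] -/
@[simp] lemma yK_zero (τ κ : ℝ) : yK τ κ 0 = ((MK τ κ : ℝ) : ℂ) := by simp [yK, u]

/-- `y(κ)₁ = κ`. [folklore] -/
@[simp] lemma yK_one (τ κ : ℝ) : yK τ κ 1 = ((κ : ℝ) : ℂ) := by simp [yK, u]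

/-- THE MC VECTORS `z(κ) = (0, ζ(κ))` of the family. [folklore] -/
def zK (τ κ : ℝ) : C2 := ((ζK τ κ : ℝ) : ℂ) • u 1

/-- `z(κ)₀ = 0`. [folklore] -/
@[simp] lemma zK_zero (τ κ : ℝ) : zK τ κ 0 = 0 := by simp [zK, u]

/-- `z(κ)₁ = ζ(κ)`. [folklore] -/
@[simp] lemma zK_one (τ κ : ℝ) : zK τ κ 1 = ((ζK τ κ : ℝ) : ℂ) := by simp [zK, u]

/-- THE COEFFICIENT OPERATORS OF THE FAMILY ARE THE PAPER'S `V_y`, `y = y(κ)`. [cite: Enflo2023, v2 (2) p.2] -/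
def WK (τ κ : ℝ) (hτ : 0 < τ) (hτ1 : τ < 1) : ℓ2 →L[ℂ] C2 := Vy.V (TD τ) (norm_TD_lt hτ.le hτ1) (yK τ κ)

/-- `V_y` intertwines. [cite: Enflo2023, v2 (9) p.4] -/
lemma WK_intertwine (hτ : 0 < τ) (hτ1 : τ < 1) (κ : ℝ) (b : ℓ2) :
    WK τ κ hτ hτ1 (S b) = TD τ (WK τ κ hτ hτ1 b) :=
  V_shift _ _ _ b

/-- `c_i(V_{y(κ)}) = conj y(κ)_i`. [cite: Enflo2023, v2 (3)–(4) p.2] -/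
lemma cf_WK (hτ : 0 < τ) (hτ1 : τ < 1) (κ : ℝ) (i : Fin 2) : cf (WK τ κ hτ hτ1) i = conj (yK τ κ i) := by
  rw [cf, WK, u, adjoint_V_coord, pow_zero, one_apply_eq_self, EuclideanSpace.inner_single_right, one_mul]

/-- `c₀ = M(κ)`. [folklore] -/
lemma cf_WK_zero (hτ : 0 < τ) (hτ1 : τ < 1) (κ : ℝ) : cf (WK τ κ hτ hτ1) 0 = ((MK τ κ : ℝ) : ℂ) := by
  rw [cf_WK, yK_zero, Complex.conj_ofReal]

/-- `c₁ = κ`. [folklore] -/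
lemma cf_WK_one (hτ : 0 < τ) (hτ1 : τ < 1) (κ : ℝ) : cf (WK τ κ hτ hτ1) 1 = ((κ : ℝ) : ℂ) := by
  rw [cf_WK, yK_one, Complex.conj_ofReal]

/-- signs: `0 < s(κ)`, `0 < ζ(κ) ≤ 3/5`, `0 < M(κ)` for `κ > 0`, `0 < τ ≤ 1/2`. [folklore] -/
lemma family_pos (hτ : 0 < τ) (hτ1 : τ ≤ 1 / 2) {κ : ℝ} (hκ : 0 < κ) :
    0 < sK τ κ ∧ 0 < ζK τ κ ∧ ζK τ κ ≤ 3 / 5 ∧ 0 < MK τ κ := by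
  obtain ⟨h11, -, -, hG⟩ := G_bounds hτ hτ1
  have hs : 0 < sK τ κ := by rw [sK]; exact mul_pos (mul_pos hκ hκ) (by linarith)
  have hζ : 0 < ζK τ κ := by rw [ζK]; positivity
  have hζ1 : ζK τ κ ≤ 3 / 5 := by
    rw [ζK, div_le_iff₀ (by linarith)]; nlinarith
  exact ⟨hs, hζ, hζ1, by rw [MK]; exact div_pos (by norm_num) (mul_pos (mul_pos hζ hκ) hG)⟩

/-- the radius window: `0.3 ≤ ζ(κ) ≤ 0.6` as soon as `s(κ) ≤ 1`. [cite: Enflo2023, v2 p.17 (window of `ε`)] -/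
lemma ζK_window (hτ : 0 < τ) (hτ1 : τ ≤ 1 / 2) {κ : ℝ} (hκ : 0 < κ) (hs : sK τ κ ≤ 1) :
    (0.3 : ℝ) ≤ ζK τ κ ∧ ζK τ κ ≤ 0.7 := by
  obtain ⟨hs0, -, hζ1, -⟩ := family_pos hτ hτ1 hκ
  refine ⟨?_, by linarith⟩
  rw [ζK, le_div_iff₀ (by linarith)]; nlinarith

/-- `‖z(κ)‖ = ζ(κ)`. [folklore] -/
lemma norm_zK (hτ : 0 < τ) (hτ1 : τ ≤ 1 / 2) {κ : ℝ} (hκ : 0 < κ) : ‖zK τ κ‖ = ζK τ κ := by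
  obtain ⟨-, hζ, -, -⟩ := family_pos hτ hτ1 hκ
  rw [zK, norm_smul, Complex.norm_real, Real.norm_of_nonneg hζ.le, u, PiLp.norm_single, norm_one, mul_one]

/-- **EVERY MEMBER OF THE FAMILY IS A BRACKET POINT**: `z(κ) + V_yV_y†z(κ) = x₀` — both coordinates of
`u₁ + V_yV_y†u₁` scale by the same factor `1 + s(κ)`. [cite: Enflo2023, v2 (15) p.6] -/
lemma isBracket_K (hτ : 0 < τ) (hτ1 : τ ≤ 1 / 100) {κ : ℝ} (hκ : 0 < κ) :
    IsBracket (WK τ κ hτ (by linarith)) xD (zK τ κ) := by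
  have hlt : τ < 1 := by linarith
  obtain ⟨hs, hζ, -, hM⟩ := family_pos hτ (by linarith) hκ
  have hK := K_apply hτ hlt (WK_intertwine hτ hlt κ) (zK τ κ)
  obtain ⟨-, -, -, hG⟩ := G_bounds hτ (by linarith)
  have r0 : MK τ κ * (ζK τ κ * κ * G τ 0 1) = 4 / 5 := by
    rw [MK]; exact div_mul_cancel₀ _ (mul_pos (mul_pos hζ hκ) hG).ne'
  have r1 : ζK τ κ + κ * (ζK τ κ * κ * G τ 1 1) = 3 / 5 := by
    have e : ζK τ κ + κ * (ζK τ κ * κ * G τ 1 1) = ζK τ κ * (1 + sK τ κ) := by rw [sK]; ring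
    rw [e, ζK, div_mul_cancel₀ _ (by linarith)]
  show zK τ κ + WK τ κ hτ hlt (adjoint (WK τ κ hτ hlt) (zK τ κ)) = xD
  ext i
  fin_cases i
  · show zK τ κ 0 + WK τ κ hτ hlt (adjoint (WK τ κ hτ hlt) (zK τ κ)) 0 = xD 0
    rw [hK, zK_zero, zK_one, xD_zero, cf_WK_zero, cf_WK_one, Complex.conj_ofReal, zero_mul, zero_mul,
      zero_add, zero_add, ← Complex.ofReal_mul, ← Complex.ofReal_mul, ← Complex.ofReal_mul, r0]
  · show zK τ κ 1 + WK τ κ hτ hlt (adjoint (WK τ κ hτ hlt) (zK τ κ)) 1 = xD 1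
    rw [hK, zK_zero, zK_one, xD_one, cf_WK_zero, cf_WK_one, Complex.conj_ofReal, zero_mul, zero_mul, zero_add,
      ← Complex.ofReal_mul, ← Complex.ofReal_mul, ← Complex.ofReal_mul, ← Complex.ofReal_add, r1]

/-- `‖V_y†z(κ)‖² = ζ(κ)²s(κ)` (`= (εθ)` of the family's state at `κ`). [cite: Enflo2023, v2 (16) p.6] -/
lemma norm_adjoint_K_sq (hτ : 0 < τ) (hτ1 : τ < 1) (κ : ℝ) :
    ‖adjoint (WK τ κ hτ hτ1) (zK τ κ)‖ ^ 2 = ζK τ κ ^ 2 * sK τ κ := by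
  rw [adjoint_eq hτ hτ1 (WK_intertwine hτ hτ1 κ), zK_zero, zero_mul, zero_smul, zero_add, norm_smul, mul_pow,
    norm_gv_sq (abs_wt_lt hτ hτ1 1), zK_one, cf_WK_one, ← Complex.ofReal_mul, Complex.norm_real, Real.norm_eq_abs,
    sq_abs, sK, G, wt_one]
  ring

/-- THE FAMILY'S STATES: the true MC state of `V_{y(κ)}` at radius `ζ(κ)` (bracket point `z(κ)`, minimiser
`ℓ = V_y†z(κ)` by (14)), for `κ > 0` with `s(κ) ≤ 1`. [cite: Enflo2023, v2 (14)–(15) p.5–6, p.17] -/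
def stK (hτ : 0 < τ) (hτ1 : τ ≤ 1 / 100) (κ : ℝ) (hκ : 0 < κ) (hs : sK τ κ ≤ 1) : State (TD τ) xD S :=
  ⟨WK τ κ hτ (by linarith), WK_intertwine hτ (by linarith) κ, ‖zK τ κ‖,
    by rw [norm_zK hτ (by linarith) hκ]; exact ζK_window hτ (by linarith) hκ hs,
    adjoint (WK τ κ hτ (by linarith)) (zK τ κ), (isBracket_K hτ hτ1 hκ).isMinimal⟩

variable (hτ : 0 < τ) (hτ1 : τ ≤ 1 / 100) {κ : ℝ} (hκ : 0 < κ) (hs : sK τ κ ≤ 1)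
include hτ hτ1 hκ hs

/-- its coefficient operator is `V_{y(κ)}`. [folklore] -/
lemma stK_V : (stK hτ hτ1 κ hκ hs).V = WK τ κ hτ (by linarith) := rfl

/-- its MC vector is `z(κ)`. [cite: Enflo2023, v2 (15) p.6] -/
lemma stK_v : (stK hτ hτ1 κ hκ hs).v = zK τ κ := (isBracket_K hτ hτ1 hκ).sub_eq

/-- its radius is `ζ(κ)`. [folklore] -/
lemma stK_ε : (stK hτ hτ1 κ hκ hs).ε = ζK τ κ := norm_zK hτ (by linarith) hκ

/-- its `(εθ)` is `ζ(κ)²s(κ)`. [cite: Enflo2023, v2 (16) p.6] -/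
lemma stK_etheta : (stK hτ hτ1 κ hκ hs).etheta = ζK τ κ ^ 2 * sK τ κ := by
  rw [etheta_eq_eth, stK_v, eth_eq_of_isBracket (isBracket_K hτ hτ1 hκ), norm_adjoint_K_sq]

/-- … which is positive. [folklore] -/
lemma stK_etheta_pos : 0 < (stK hτ hτ1 κ hκ hs).etheta := by
  obtain ⟨hs0, hζ, -, -⟩ := family_pos hτ (by linarith) hκ
  rw [stK_etheta]; positivity

/-- the state is bracket-normalised: `‖ℓ‖² = (εθ)`, so `Wn = V_y` (multiplier `1`). [cite: Enflo2023, v2 (5)–(6) p.3, (16) p.6] -/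
lemma Wn_stK : Wn (stK hτ hτ1 κ hκ hs) = WK τ κ hτ (by linarith) := by
  have he : ‖(stK hτ hτ1 κ hκ hs).a‖ ^ 2 = (stK hτ hτ1 κ hκ hs).etheta := by
    rw [stK_etheta]; exact norm_adjoint_K_sq hτ (by linarith) κ
  rw [Wn, he, div_self (stK_etheta_pos hτ hτ1 hκ hs).ne', Real.sqrt_one, Complex.ofReal_one, one_smul]
  rfl

/-- both eigen-coordinates of the run vector are non-zero: `y(κ)` is CYCLIC for `T_τ`. [folklore] -/
lemma cf_stK_ne : ∀ i, cf (stK hτ hτ1 κ hκ hs).V i ≠ 0 := by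
  obtain ⟨-, -, -, hM⟩ := family_pos hτ (by linarith) hκ
  have hlt : τ < 1 := by linarith
  refine Fin.forall_fin_two.2 ⟨?_, ?_⟩
  · rw [stK_V, cf_WK_zero]; exact_mod_cast hM.ne'
  · rw [stK_V, cf_WK_one]; exact_mod_cast hκ.ne'

end family

/-! ### C. The admissible step inside the family: `κ → tκ` along `N = φ₀ + φ₁S ∈ {S}'`, and its arithmetic -/

section step

variable {τ : ℝ}

/-- THE STEP DIRECTIONS `N = φ₀·1 + φ₁·S` — degree-one real polynomials in the shift (the text's `y → y + r(T)y`
with `r` linear). [cite: Enflo2023, v2 p.16 (`T^j(y' + r(T)y')`)] -/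
def Ndir (φ₀ φ₁ : ℝ) : ℓ2 →L[ℂ] ℓ2 := ((φ₀ : ℝ) : ℂ) • (1 : ℓ2 →L[ℂ] ℓ2) + ((φ₁ : ℝ) : ℂ) • S

/-- `N b = φ₀b + φ₁Sb`. [folklore] -/
lemma Ndir_apply (φ₀ φ₁ : ℝ) (b : ℓ2) : Ndir φ₀ φ₁ b = ((φ₀ : ℝ) : ℂ) • b + ((φ₁ : ℝ) : ℂ) • S b := by
  rw [Ndir, add_apply, smul_apply, smul_apply, one_apply_eq_self]

/-- `N` commutes with `S`. [folklore] -/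
lemma Ndir_comm (φ₀ φ₁ : ℝ) : Ndir φ₀ φ₁ ∘L S = S ∘L Ndir φ₀ φ₁ := by
  refine ContinuousLinearMap.ext fun b => ?_
  rw [comp_apply, comp_apply, Ndir_apply, Ndir_apply, map_add, map_smul, map_smul]

/-- the direction as an element of the commutant `{S}'` (the direction space of `ReachD (ιS S)`). [folklore] -/
def pdir (φ₀ φ₁ : ℝ) : Comm (S : ℓ2 →L[ℂ] ℓ2) := ⟨Ndir φ₀ φ₁, Ndir_comm φ₀ φ₁⟩

/-- `ιS S (pdir φ₀ φ₁) = N`. [folklore] -/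
lemma ιS_pdir (φ₀ φ₁ : ℝ) : ιS S (pdir φ₀ φ₁) = Ndir φ₀ φ₁ := rfl

/-- `‖N‖ ≤ |φ₀| + |φ₁|` (`‖S‖ ≤ 1`). [folklore] -/
lemma norm_pdir_le (φ₀ φ₁ : ℝ) : ‖pdir φ₀ φ₁‖ ≤ |φ₀| + |φ₁| := by
  show ‖Ndir φ₀ φ₁‖ ≤ _
  have h0 : ‖(1 : ℓ2 →L[ℂ] ℓ2)‖ ≤ 1 := by rw [one_def]; exact norm_id_le
  have h1 : ‖((φ₀ : ℝ) : ℂ) • (1 : ℓ2 →L[ℂ] ℓ2)‖ ≤ |φ₀| := by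
    rw [norm_smul, Complex.norm_real, Real.norm_eq_abs]
    exact mul_le_of_le_one_right (abs_nonneg _) h0
  have h2 : ‖((φ₁ : ℝ) : ℂ) • (S : ℓ2 →L[ℂ] ℓ2)‖ ≤ |φ₁| := by
    rw [norm_smul, Complex.norm_real, Real.norm_eq_abs]
    exact mul_le_of_le_one_right (abs_nonneg _) norm_S_le
  exact (norm_add_le _ _).trans (add_le_add h1 h2)

/-- `g_μ` is an eigenvector of `N†`: `⟪g_μ, Nb⟫ = (φ₀ + φ₁μ)⟪g_μ, b⟫`. [folklore] -/
lemma inner_gv_Ndir {μ : ℝ} (hμ : |μ| < 1) (φ₀ φ₁ : ℝ) (b : ℓ2) :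
    ⟪gv μ, Ndir φ₀ φ₁ b⟫_ℂ = ((φ₀ + φ₁ * μ : ℝ) : ℂ) * ⟪gv μ, b⟫_ℂ := by
  rw [Ndir_apply, inner_add_right, inner_smul_right, inner_smul_right, inner_gv_S hμ]
  push_cast; ring

/-- **THE STEP ON RUN VECTORS IS A COMMUTANT RESHAPING**: if `y(κ')_i = y(κ)_i·(1 + φ₀ + φ₁wt_i)` for both `i`,
then `V_{y(κ')} = V_{y(κ)} ∘ (1 + N)`, `N = φ₀ + φ₁S`. [cite: Enflo2023, v2 p.16 (`y → y + r(T)y`), (41)–(44) p.18] -/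
lemma WK_comp (hτ : 0 < τ) (hτ1 : τ < 1) {κ κ' φ₀ φ₁ : ℝ}
    (h : ∀ i, yK τ κ' i = yK τ κ i * (((1 + (φ₀ + φ₁ * wt τ i) : ℝ)) : ℂ)) :
    WK τ κ' hτ hτ1 = WK τ κ hτ hτ1 ∘L (1 + Ndir φ₀ φ₁) := by
  refine ContinuousLinearMap.ext fun b => ?_
  ext i
  rw [comp_apply, apply_coord hτ hτ1 (WK_intertwine hτ hτ1 κ') b i,
    apply_coord hτ hτ1 (WK_intertwine hτ hτ1 κ) _ i, add_apply, one_apply_eq_self, inner_add_right,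
    inner_gv_Ndir (abs_wt_lt hτ hτ1 i), cf_WK, cf_WK, h i]
  simp only [map_mul, Complex.conj_conj, Complex.conj_ofReal]
  push_cast; ring

/-- `s(tκ) = t²s(κ)`. [folklore] -/
lemma sK_mul (τ t κ : ℝ) : sK τ (t * κ) = t ^ 2 * sK τ κ := by
  rw [sK, sK]; ring

/-- `s(κ) ≥ 0`. [folklore] -/
lemma sK_nonneg (hτ : 0 < τ) (hτ1 : τ ≤ 1 / 2) (κ : ℝ) : 0 ≤ sK τ κ := by
  obtain ⟨h11, -, -, -⟩ := G_bounds hτ hτ1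
  rw [sK]; exact mul_nonneg (mul_self_nonneg κ) (by linarith)

/-- closed form `M(κ) = 4(1 + s(κ))/(3κG₀₁)`. [folklore] -/
lemma MK_eq (hτ : 0 < τ) (hτ1 : τ ≤ 1 / 2) {κ : ℝ} (hκ : κ ≠ 0) :
    MK τ κ = 4 * (1 + sK τ κ) / (3 * κ * G τ 0 1) := by
  obtain ⟨-, -, -, hG⟩ := G_bounds hτ hτ1
  have hs : 0 ≤ sK τ κ := sK_nonneg hτ hτ1 κ
  have h1 : (1 + sK τ κ) ≠ 0 := by linarith
  have h2 : 3 / 5 / (1 + sK τ κ) * κ * G τ 0 1 ≠ 0 := by positivity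
  rw [MK, ζK, div_eq_div_iff h2 (by positivity)]
  field_simp

/-- THE STEP POLYNOMIAL'S COEFFICIENTS: `φ(z) = φ₀ + φ₁z` with `φ(τ) = A`, `φ(τ/2) = B`. [folklore] -/
def φ1c (τ A B : ℝ) : ℝ := (A - B) / (τ / 2)

/-- (see `φ1c`). [folklore] -/
def φ0c (τ A B : ℝ) : ℝ := A - φ1c τ A B * τ

/-- `φ(wt₀) = A`. [folklore] -/
lemma φc_wt_zero (τ A B : ℝ) : φ0c τ A B + φ1c τ A B * wt τ 0 = A := by
  rw [wt_zero, φ0c]; ring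

/-- `φ(wt₁) = B`. [folklore] -/
lemma φc_wt_one (hτ : τ ≠ 0) (A B : ℝ) : φ0c τ A B + φ1c τ A B * wt τ 1 = B := by
  have e : φ1c τ A B * (τ / 2) = A - B := by rw [φ1c]; exact div_mul_cancel₀ _ (by positivity)
  rw [wt_one, φ0c]; linear_combination (-1 : ℝ) * e

/-- THE NORM BUDGET: `|φ₀| + |φ₁| ≤ 2β/σ` when `|A| ≤ 1.01β`, `|B| ≤ 2β`, `σ ≤ τ/4`, `τ ≤ 1/100`
(`|φ₁| ≤ 6.02β/τ`, `|φ₀| ≤ 7.03β`). [folklore] -/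
lemma φc_norm {σ β A B : ℝ} (hτ : 0 < τ) (hτ1 : τ ≤ 1 / 100) (hσ : 0 < σ) (hστ : σ ≤ τ / 4) (hβ0 : 0 ≤ β)
    (hA : |A| ≤ 1.01 * β) (hB : |B| ≤ 2 * β) : |φ0c τ A B| + |φ1c τ A B| ≤ 2 * β / σ := by
  have hAB : |A - B| ≤ 3.01 * β := (abs_sub A B).trans (by linarith)
  have h1 : |φ1c τ A B| ≤ 6.02 * β / τ := by
    rw [φ1c, abs_div, abs_of_pos (by positivity : (0 : ℝ) < τ / 2), div_le_div_iff₀ (by positivity) hτ]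
    nlinarith [mul_le_mul_of_nonneg_right hAB hτ.le]
  have h1τ : |φ1c τ A B * τ| ≤ 6.02 * β := by
    rw [abs_mul, abs_of_pos hτ]
    have := mul_le_mul_of_nonneg_right h1 hτ.le
    rwa [div_mul_cancel₀ _ hτ.ne'] at this
  have h0 : |φ0c τ A B| ≤ 7.03 * β := by
    rw [φ0c]; exact (abs_sub _ _).trans (by linarith)
  have h3 : 7.03 * β ≤ 1.98 * β / τ := by
    rw [le_div_iff₀ hτ]; nlinarith [mul_le_mul_of_nonneg_left hτ1 hβ0]
  have h4 : 1.98 * β / τ + 6.02 * β / τ = 8 * β / τ := by ring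
  have h5 : 8 * β / τ ≤ 2 * β / σ := by
    rw [div_le_div_iff₀ hτ hσ]; nlinarith [mul_le_mul_of_nonneg_left hστ hβ0]
  linarith

/-- THE ROOT DEFINING THE NEXT PARAMETER: `t(1+s) = √(1−β)·(1 + t²s)` has a solution `t ∈ (0,1)`
(intermediate value theorem). [folklore] -/
lemma exists_root {β s : ℝ} (hβ0 : 0 < β) (hβ1 : β < 1) (hs : 0 ≤ s) :
    ∃ t : ℝ, 0 < t ∧ t < 1 ∧ t * (1 + s) = Real.sqrt (1 - β) * (1 + t ^ 2 * s) := by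
  have hρ0 : 0 < Real.sqrt (1 - β) := Real.sqrt_pos.2 (by linarith)
  have hρ1 : Real.sqrt (1 - β) < 1 := by
    rw [Real.sqrt_lt' one_pos]; linarith
  let g : ℝ → ℝ := fun t => t * (1 + s) - Real.sqrt (1 - β) * (1 + t ^ 2 * s)
  have hg : Continuous g := by fun_prop
  have h0 : g 0 < 0 := by
    have e : g 0 = -Real.sqrt (1 - β) := by simp only [g]; ring
    rw [e]; linarith
  have h1 : 0 < g 1 := by
    have e : g 1 = (1 + s) * (1 - Real.sqrt (1 - β)) := by simp only [g]; ring
    rw [e]; exact mul_pos (by linarith) (by linarith)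
  obtain ⟨t, ⟨ht0, ht1⟩, ht⟩ := intermediate_value_Ioo zero_le_one hg.continuousOn ⟨h0, h1⟩
  exact ⟨t, ht0, ht1, by simpa only [g, sub_eq_zero] using ht⟩

/-- the next-parameter ratio `t(β, s) ∈ (0,1)` (a chosen root; `1` off the meaningful range). [folklore] -/
def tR (β s : ℝ) : ℝ :=
  if h : 0 < β ∧ β < 1 ∧ 0 ≤ s then Classical.choose (exists_root h.1 h.2.1 h.2.2) else 1

/-- its defining properties. [folklore] -/
lemma tR_spec {β s : ℝ} (hβ0 : 0 < β) (hβ1 : β < 1) (hs : 0 ≤ s) :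
    0 < tR β s ∧ tR β s < 1 ∧ tR β s * (1 + s) = Real.sqrt (1 - β) * (1 + tR β s ^ 2 * s) := by
  rw [tR, dif_pos ⟨hβ0, hβ1, hs⟩]
  exact Classical.choose_spec (exists_root hβ0 hβ1 hs)

/-- ARITHMETIC OF ONE STEP.  With `ρ = √(1−β)`, `t(1+s) = ρ(1+t²s)`, `0 ≤ s ≤ β ≤ 1/1000`: the multipliers
`A = 1/ρ − 1` (big coordinate; EXACT, `s`-free) and `B = t − 1` (small coordinate) are `O(β)`, the `(εθ)`-ratio
identity `t²(1+s)² = (1−β)(1+t²s)²` holds, and `s' = t²s ≤ (1−β)s`. [folklore] -/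
lemma step_arith {β s t : ℝ} (hβ0 : 0 < β) (hβ1 : β ≤ 1 / 1000) (hs0 : 0 ≤ s) (hsβ : s ≤ β)
    (ht0 : 0 < t) (ht1 : t < 1) (hg : t * (1 + s) = Real.sqrt (1 - β) * (1 + t ^ 2 * s)) :
    |1 / Real.sqrt (1 - β) - 1| ≤ 1.01 * β ∧ |t - 1| ≤ 2 * β ∧
    t ^ 2 * (1 + s) ^ 2 = (1 - β) * (1 + t ^ 2 * s) ^ 2 ∧ t ^ 2 * s ≤ (1 - β) * s := by
  have hρ0 : 0 < Real.sqrt (1 - β) := Real.sqrt_pos.2 (by linarith)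
  have hρ2 : Real.sqrt (1 - β) ^ 2 = 1 - β := Real.sq_sqrt (by linarith)
  generalize Real.sqrt (1 - β) = ρ at hg hρ0 hρ2 ⊢
  have hρ1 : ρ < 1 := by nlinarith
  have hρρ : ρ ^ 2 ≤ ρ := by nlinarith [mul_nonneg hρ0.le (sub_nonneg.2 hρ1.le)]
  have hρlo : 1 - β ≤ ρ := by linarith
  -- the big-coordinate multiplier `A = 1/ρ − 1`
  have hA0 : 0 ≤ 1 / ρ - 1 := by
    rw [sub_nonneg, le_div_iff₀ hρ0]; linarith
  have hA1 : 1 / ρ - 1 ≤ 1.01 * β := by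
    rw [div_sub_one hρ0.ne', div_le_iff₀ hρ0]
    nlinarith [mul_nonneg hβ0.le (by linarith : (0 : ℝ) ≤ ρ - 0.999)]
  -- the small-coordinate multiplier `B = t − 1`
  have hts : 0 ≤ t ^ 2 * s := by positivity
  have ht2 : t ^ 2 * s ≤ s := mul_le_of_le_one_left hs0 (by nlinarith)
  have htlo : ρ ≤ t * (1 + s) := by
    rw [hg]; exact le_mul_of_one_le_right hρ0.le (by linarith)
  have hB1 : 1 - t ≤ 2 * β := by nlinarith [mul_nonneg (sub_nonneg.2 ht1.le) hs0]
  -- `t ≤ ρ` and the ratio identity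
  have htρ : t ≤ ρ := by nlinarith
  have hid : t ^ 2 * (1 + s) ^ 2 = (1 - β) * (1 + t ^ 2 * s) ^ 2 := by
    rw [← hρ2]; linear_combination (t * (1 + s) + ρ * (1 + t ^ 2 * s)) * hg
  refine ⟨by rw [abs_of_nonneg hA0]; exact hA1, by rw [abs_sub_comm, abs_of_nonneg (by linarith)]; exact hB1,
    hid, ?_⟩
  rw [← hρ2]
  exact mul_le_mul_of_nonneg_right (by nlinarith) hs0

/-- ARITHMETIC OF THE TWO DRIFT BOUNDS along the step `s → s' = t²s` (`ζ = 0.6/(1+s)`, `ζ' = 0.6/(1+s')`):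
`0 ≤ ζ' − ζ`, `0.6(ζ' − ζ) ≤ 22β·ζ²s` and `ζ'² − ζ² ≤ 23β·ζ²s`. [folklore] -/
lemma drift_arith {β s t ζ ζ' : ℝ} (hβ0 : 0 < β) (hs0 : 0 ≤ s) (ht0 : 0 < t) (ht1 : t ≤ 1)
    (hB : |t - 1| ≤ 2 * β) (hζ : ζ * (1 + s) = 3 / 5) (hζ' : ζ' * (1 + t ^ 2 * s) = 3 / 5)
    (hζlo : 0.3 ≤ ζ) (hζhi : ζ ≤ 0.6) (hζ'hi : ζ' ≤ 0.6) :
    0 ≤ ζ' - ζ ∧ 3 / 5 * (ζ' - ζ) ≤ 22 * β * (ζ ^ 2 * s) ∧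
      (ζ ≤ ζ' ∧ ζ' ^ 2 - ζ ^ 2 ≤ 23 * β * (ζ ^ 2 * s)) := by
  have hB' : 1 - t ≤ 2 * β := by rw [abs_sub_comm, abs_of_nonneg (by linarith)] at hB; exact hB
  have hts : 0 ≤ t ^ 2 * s := by positivity
  have hss' : t ^ 2 * s ≤ s := mul_le_of_le_one_left hs0 (by nlinarith)
  have hpos : 0 < 1 + t ^ 2 * s := by positivity
  have e1 : (ζ' - ζ) * (1 + t ^ 2 * s) = ζ * (s - t ^ 2 * s) := by linear_combination hζ' - hζ
  have h1 : 0 ≤ ζ' - ζ := by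
    have : 0 ≤ (ζ' - ζ) * (1 + t ^ 2 * s) := by
      rw [e1]; exact mul_nonneg (by linarith) (by linarith)
    exact nonneg_of_mul_nonneg_left this hpos
  have e2 : s - t ^ 2 * s ≤ 4 * β * s := by nlinarith [mul_nonneg (sub_nonneg.2 ht1) hs0]
  have hd : ζ' - ζ ≤ 4 * β * s * ζ := by
    nlinarith [mul_nonneg h1 hts, mul_le_mul_of_nonneg_left e2 (by linarith : (0 : ℝ) ≤ ζ)]
  have hβsζ : 0 ≤ β * s * ζ := mul_nonneg (mul_nonneg hβ0.le hs0) (by linarith)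
  have hkey : 0 ≤ β * s * ζ * (ζ - 0.3) := mul_nonneg hβsζ (by linarith)
  refine ⟨h1, by nlinarith [hkey], by linarith, ?_⟩
  have h3 : ζ' ^ 2 - ζ ^ 2 = (ζ' - ζ) * (ζ' + ζ) := by ring
  rw [h3]
  nlinarith [mul_le_mul hd (by linarith : ζ' + ζ ≤ 1.2) (by linarith) (by positivity), hkey]

/-- THE `(εθ)`-RATIO inside the family: `ζ(s')²s' = (1−β)ζ(s)²s` when `t²(1+s)² = (1−β)(1+t²s)²`. [folklore] -/
lemma ratio_arith {β s t : ℝ} (hs : 0 ≤ s) (hid : t ^ 2 * (1 + s) ^ 2 = (1 - β) * (1 + t ^ 2 * s) ^ 2) :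
    (3 / 5 / (1 + t ^ 2 * s)) ^ 2 * (t ^ 2 * s) = (1 - β) * ((3 / 5 / (1 + s)) ^ 2 * s) := by
  have h1 : (1 + s) ≠ 0 := by positivity
  have h2 : (1 + t ^ 2 * s) ≠ 0 := by positivity
  have key : t ^ 2 * s / (1 + t ^ 2 * s) ^ 2 = (1 - β) * s / (1 + s) ^ 2 := by
    rw [div_eq_div_iff (pow_ne_zero 2 h2) (pow_ne_zero 2 h1)]
    linear_combination s * hid
  calc (3 / 5 / (1 + t ^ 2 * s)) ^ 2 * (t ^ 2 * s) = (3 / 5) ^ 2 * (t ^ 2 * s / (1 + t ^ 2 * s) ^ 2) := by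
        rw [div_pow (3 / 5 : ℝ) (1 + t ^ 2 * s) 2]; ring
    _ = (3 / 5) ^ 2 * ((1 - β) * s / (1 + s) ^ 2) := by rw [key]
    _ = (1 - β) * ((3 / 5 / (1 + s)) ^ 2 * s) := by
        rw [div_pow (3 / 5 : ℝ) (1 + s) 2]; ring

/-- THE START MARGIN: at `s = β`, `ζ = 0.6/(1+β)`, `(εθ)₀ = ζ²β`, `ε₀ = ζ`, the run's start condition
`0.09 + (22/σ + 1)(εθ)₀ ≤ ε₀² ≤ 0.49 − (22/σ + 1)(εθ)₀` holds when `β ≤ σ²/1000`, `σ ≤ 1`. [folklore] -/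
lemma start_arith {σ β ζ : ℝ} (hσ : 0 < σ) (hσ1 : σ ≤ 1) (hβ0 : 0 < β) (hβ : β ≤ σ ^ 2 / 1000)
    (hζ : ζ * (1 + β) = 3 / 5) (hζ0 : 0 < ζ) :
    (0.09 : ℝ) + (22 / σ + 1) * (ζ ^ 2 * β) ≤ ζ ^ 2 ∧ ζ ^ 2 + (22 / σ + 1) * (ζ ^ 2 * β) ≤ 0.49 := by
  have hβ1 : β ≤ 1 / 1000 := hβ.trans (div_le_div_of_nonneg_right (by nlinarith) (by norm_num))
  have hζhi : ζ ≤ 0.6 := by nlinarith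
  have hζlo : 0.599 ≤ ζ := by nlinarith [mul_le_mul_of_nonneg_right hζhi hβ0.le]
  have h1 : ζ ^ 2 * β ≤ 0.36 * β := by nlinarith
  have h2 : 22 / σ * β ≤ 22 * σ / 1000 := by
    rw [div_mul_eq_mul_div, div_le_iff₀ hσ]; nlinarith
  have h3 : (22 / σ + 1) * (ζ ^ 2 * β) ≤ (22 / σ + 1) * (0.36 * β) :=
    mul_le_mul_of_nonneg_left h1 (by positivity)
  have e : (22 / σ + 1) * (0.36 * β) = 0.36 * (22 / σ * β) + 0.36 * β := by ring
  rw [e] at h3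
  constructor <;> nlinarith

end step

/-! ### D. One admissible step inside the family, and the infinite scheduled orbit `κ_{n+1} = t_nκ_n` -/

section onestep

variable {τ : ℝ} (hτ : 0 < τ) (hτ1 : τ ≤ 1 / 100) {β : ℝ} (hβ0 : 0 < β) (hβ1 : β ≤ 1 / 1000)
  {κ t : ℝ} (hκ : 0 < κ) (hsβ : sK τ κ ≤ β) (ht0 : 0 < t) (ht1 : t < 1)
  (hg : t * (1 + sK τ κ) = Real.sqrt (1 - β) * (1 + t ^ 2 * sK τ κ))
  (hs1 : sK τ κ ≤ 1) (hs1' : sK τ (t * κ) ≤ 1)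
include hτ hτ1 hβ0 hβ1 hκ hsβ ht0 ht1 hg

/-- **THE STEP `κ → tκ` IS A COMMUTANT RESHAPING OF ADMISSIBLE SIZE**: `V_{y(tκ)} = W(1 + N)` with
`N = φ₀ + φ₁S ∈ {S}'`, `‖N‖ ≤ 2β/σ` (for `σ ≤ τ/4`). [cite: Enflo2023, v2 (41)–(44) p.18; p.16 (`y → y + r(T)y`)] -/
theorem step_V {σ : ℝ} (hσ : 0 < σ) (hστ : σ ≤ τ / 4) : ∃ p : Comm (S : ℓ2 →L[ℂ] ℓ2), ‖p‖ ≤ 2 * β / σ ∧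
    (stK hτ hτ1 (t * κ) (mul_pos ht0 hκ) hs1').V = Wn (stK hτ hτ1 κ hκ hs1) ∘L (1 + ιS S p) := by
  have hlt : τ < 1 := by linarith
  have hτ2 : τ ≤ 1 / 2 := by linarith
  obtain ⟨hA, hB, -, -⟩ := step_arith hβ0 hβ1 (sK_nonneg hτ hτ2 κ) hsβ ht0 ht1 hg
  refine ⟨pdir (φ0c τ (1 / Real.sqrt (1 - β) - 1) (t - 1)) (φ1c τ (1 / Real.sqrt (1 - β) - 1) (t - 1)),
    (norm_pdir_le _ _).trans (φc_norm hτ hτ1 hσ hστ hβ0.le hA hB), ?_⟩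
  rw [stK_V, Wn_stK hτ hτ1 hκ hs1, ιS_pdir]
  refine WK_comp hτ hlt (Fin.forall_fin_two.2 ⟨?_, ?_⟩)
  · rw [yK_zero, yK_zero, φc_wt_zero, MK_eq hτ hτ2 (mul_pos ht0 hκ).ne', MK_eq hτ hτ2 hκ.ne', sK_mul]
    obtain ⟨-, -, -, hG⟩ := G_bounds hτ hτ2
    have hρ0 : 0 < Real.sqrt (1 - β) := Real.sqrt_pos.2 (by linarith)
    have hs0 := sK_nonneg hτ hτ2 κ
    have e : 4 * (1 + t ^ 2 * sK τ κ) / (3 * (t * κ) * G τ 0 1) =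
        4 * (1 + sK τ κ) / (3 * κ * G τ 0 1) * (1 + (1 / Real.sqrt (1 - β) - 1)) := by
      rw [add_sub_cancel, mul_one_div, div_div, div_eq_div_iff (by positivity) (by positivity)]
      linear_combination (-(12 * κ * G τ 0 1)) * hg
    rw [e]; push_cast; ring
  · rw [yK_one, yK_one, φc_wt_one hτ.ne']; push_cast; ring

/-- **THE STEP HAS EXACTLY THE RATIO `1 − β`**: `(εθ)(tκ) = (1−β)(εθ)(κ)`. [cite: Enflo2023, v2 (b′) p.17] -/
theorem step_ratio :
    (stK hτ hτ1 (t * κ) (mul_pos ht0 hκ) hs1').etheta = (1 - β) * (stK hτ hτ1 κ hκ hs1).etheta := by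
  have hτ2 : τ ≤ 1 / 2 := by linarith
  obtain ⟨-, -, hid, -⟩ := step_arith hβ0 hβ1 (sK_nonneg hτ hτ2 κ) hsβ ht0 ht1 hg
  rw [stK_etheta, stK_etheta, ζK, ζK, sK_mul]
  exact ratio_arith (sK_nonneg hτ hτ2 κ) hid

/-- the drift data of the step: `ζ = ζ(κ)`, `ζ' = ζ(tκ)` satisfy the hypotheses of `drift_arith`. [folklore] -/
lemma step_drift_data :
    0 ≤ ζK τ (t * κ) - ζK τ κ ∧ 3 / 5 * (ζK τ (t * κ) - ζK τ κ) ≤ 22 * β * (ζK τ κ ^ 2 * sK τ κ) ∧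
      (ζK τ κ ≤ ζK τ (t * κ) ∧ ζK τ (t * κ) ^ 2 - ζK τ κ ^ 2 ≤ 23 * β * (ζK τ κ ^ 2 * sK τ κ)) := by
  have hτ2 : τ ≤ 1 / 2 := by linarith
  have hs0 := sK_nonneg hτ hτ2 κ
  obtain ⟨-, hB, -, -⟩ := step_arith hβ0 hβ1 hs0 hsβ ht0 ht1 hg
  have hζ : ζK τ κ * (1 + sK τ κ) = 3 / 5 := by rw [ζK]; exact div_mul_cancel₀ _ (by positivity)
  have hζ' : ζK τ (t * κ) * (1 + t ^ 2 * sK τ κ) = 3 / 5 := by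
    rw [ζK, sK_mul]; exact div_mul_cancel₀ _ (by positivity)
  obtain ⟨-, -, hζhi, -⟩ := family_pos hτ hτ2 hκ
  obtain ⟨-, -, hζ'hi, -⟩ := family_pos hτ hτ2 (mul_pos ht0 hκ)
  have hζlo : (0.3 : ℝ) ≤ ζK τ κ := (ζK_window hτ hτ2 hκ (hsβ.trans (by linarith))).1
  exact drift_arith hβ0 hs0 ht0 ht1.le hB hζ hζ' hζlo (hζhi.trans (by norm_num)) (hζ'hi.trans (by norm_num))

/-- **THE DRIFT (45) ALONG THE STEP**: `|Re⟨x₀, v' − v⟩| ≤ (22/σ)β(εθ)`. [cite: Enflo2023, v2 (45) p.19] -/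
theorem step_drift_v {σ : ℝ} (hσ : 0 < σ) (hσ1 : σ ≤ 1) :
    |(⟪xD, (stK hτ hτ1 (t * κ) (mul_pos ht0 hκ) hs1').v - (stK hτ hτ1 κ hκ hs1).v⟫_ℂ).re| ≤
      22 / σ * β * (stK hτ hτ1 κ hκ hs1).etheta := by
  obtain ⟨hd0, hd1, -, -⟩ := step_drift_data hτ hτ1 hβ0 hβ1 hκ hsβ ht0 ht1 hg
  have hnn : 0 ≤ (ζK τ (t * κ) - ζK τ κ) * (3 / 5) := mul_nonneg hd0 (by norm_num)
  rw [stK_v, stK_v, stK_etheta, zK, zK, ← sub_smul, inner_smul_right, inner_u_right, xD_one, Complex.conj_ofReal,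
    ← Complex.ofReal_sub, ← Complex.ofReal_mul, Complex.ofReal_re, abs_of_nonneg hnn, mul_comm]
  refine hd1.trans (mul_le_mul_of_nonneg_right (mul_le_mul_of_nonneg_right ?_ hβ0.le) ?_)
  · rw [le_div_iff₀ hσ]; nlinarith
  · exact mul_nonneg (sq_nonneg _) (sK_nonneg hτ (by linarith) κ)

/-- **THE RADIUS DRIFT ALONG THE STEP**: `|ε'² − ε²| ≤ (22/σ + 1)β(εθ)`. [cite: Enflo2023, v2 (33) p.16, (45) p.19] -/
theorem step_drift_ε {σ : ℝ} (hσ : 0 < σ) (hσ1 : σ ≤ 1) :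
    |(stK hτ hτ1 (t * κ) (mul_pos ht0 hκ) hs1').ε ^ 2 - (stK hτ hτ1 κ hκ hs1).ε ^ 2| ≤
      (22 / σ + 1) * β * (stK hτ hτ1 κ hκ hs1).etheta := by
  obtain ⟨-, -, hle, hd2⟩ := step_drift_data hτ hτ1 hβ0 hβ1 hκ hsβ ht0 ht1 hg
  obtain ⟨-, hζ, -, -⟩ := family_pos hτ (by linarith : τ ≤ 1 / 2) hκ
  have hnn : 0 ≤ ζK τ (t * κ) ^ 2 - ζK τ κ ^ 2 := sub_nonneg.2 (pow_le_pow_left₀ hζ.le hle 2)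
  rw [stK_ε, stK_ε, stK_etheta, abs_of_nonneg hnn]
  refine hd2.trans (mul_le_mul_of_nonneg_right (mul_le_mul_of_nonneg_right ?_ hβ0.le) ?_)
  · have : (22 : ℝ) ≤ 22 / σ := by rw [le_div_iff₀ hσ]; nlinarith
    linarith
  · exact mul_nonneg (sq_nonneg _) (sK_nonneg hτ (by linarith) κ)

end onestep

section run

variable {τ : ℝ}

/-- THE PARAMETER SEQUENCE: `κ₀ = √(β/G₁₁)` (so `s(κ₀) = β`), `κ_{n+1} = t(β, s(κ_n))·κ_n`. [folklore] -/
def κseq (τ β : ℝ) : ℕ → ℝ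
  | 0 => Real.sqrt (β / G τ 1 1)
  | n + 1 => tR β (sK τ (κseq τ β n)) * κseq τ β n

/-- `κ_{n+1} = t_nκ_n`. [folklore] -/
lemma κseq_succ (τ β : ℝ) (n : ℕ) : κseq τ β (n + 1) = tR β (sK τ (κseq τ β n)) * κseq τ β n := rfl

/-- `s(κ₀) = β`. [folklore] -/
lemma sK_κseq_zero (hτ : 0 < τ) (hτ1 : τ ≤ 1 / 2) {β : ℝ} (hβ : 0 ≤ β) : sK τ (κseq τ β 0) = β := by
  obtain ⟨h11, -, -, -⟩ := G_bounds hτ hτ1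
  have hG : 0 < G τ 1 1 := by linarith
  rw [κseq, sK, Real.mul_self_sqrt (div_nonneg hβ hG.le), div_mul_cancel₀ _ hG.ne']

/-- `s(κ_{n+1}) = t_n²·s(κ_n)`. [folklore] -/
lemma sK_κseq_succ (τ β : ℝ) (n : ℕ) :
    sK τ (κseq τ β (n + 1)) = tR β (sK τ (κseq τ β n)) ^ 2 * sK τ (κseq τ β n) := by
  rw [κseq_succ, sK_mul]

/-- `T_τu₀ = τu₀`: the limit direction below is an eigenvector, hence NON-CYCLIC (its closed orbit span is
`ℂu₀ ≠ ℂ²`). [folklore] -/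
lemma TD_u_zero (τ : ℝ) : TD τ (u 0) = ((τ : ℝ) : ℂ) • u 0 := by
  ext i
  fin_cases i <;> simp [TD_apply, u]

variable (hτ : 0 < τ) (hτ1 : τ ≤ 1 / 100) {β : ℝ} (hβ0 : 0 < β) (hβ1 : β ≤ 1 / 1000)
include hτ hτ1 hβ0 hβ1

/-- `κ_n > 0`. [folklore] -/
lemma κseq_pos : ∀ n, 0 < κseq τ β n
  | 0 => by
    obtain ⟨h11, -, -, -⟩ := G_bounds hτ (by linarith)
    exact Real.sqrt_pos.2 (div_pos hβ0 (by linarith))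
  | n + 1 => by
    rw [κseq_succ]
    exact mul_pos (tR_spec hβ0 (by linarith) (sK_nonneg hτ (by linarith) _)).1 (κseq_pos n)

/-- `s(κ_n) ≤ (1−β)ⁿβ` (so `s(κ_n) ≤ β ≤ 1`, and `s(κ_n) → 0`). [folklore] -/
lemma sK_κseq_le : ∀ n, sK τ (κseq τ β n) ≤ (1 - β) ^ n * β
  | 0 => by rw [sK_κseq_zero hτ (by linarith) hβ0.le, pow_zero, one_mul]
  | n + 1 => by
    have hs0 := sK_nonneg hτ (by linarith : τ ≤ 1 / 2) (κseq τ β n)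
    have ih := sK_κseq_le n
    have hsβ : sK τ (κseq τ β n) ≤ β :=
      ih.trans (mul_le_of_le_one_left hβ0.le (pow_le_one₀ (by linarith) (by linarith)))
    obtain ⟨ht0, ht1, hg⟩ := tR_spec hβ0 (by linarith : β < 1) hs0
    obtain ⟨-, -, -, hle⟩ := step_arith hβ0 hβ1 hs0 hsβ ht0 ht1 hg
    rw [sK_κseq_succ, pow_succ]
    calc _ ≤ (1 - β) * sK τ (κseq τ β n) := hle
      _ ≤ (1 - β) * ((1 - β) ^ n * β) := mul_le_mul_of_nonneg_left ih (by linarith)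
      _ = (1 - β) ^ n * (1 - β) * β := by ring

/-- `s(κ_n) ≤ β`. [folklore] -/
lemma sK_κseq_le_β (n : ℕ) : sK τ (κseq τ β n) ≤ β :=
  (sK_κseq_le hτ hτ1 hβ0 hβ1 n).trans (mul_le_of_le_one_left hβ0.le (pow_le_one₀ (by linarith) (by linarith)))

/-- THE STATES OF THE RUN: the family's states at `κ_n`. [cite: Enflo2023, v2 (14)–(15) p.5–6, p.17] -/
def fK (n : ℕ) : State (TD τ) xD S :=
  stK hτ hτ1 (κseq τ β n) (κseq_pos hτ hτ1 hβ0 hβ1 n) ((sK_κseq_le_β hτ hτ1 hβ0 hβ1 n).trans (by linarith))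

/-- **EVERY STEP OF THE RUN IS AN ADMISSIBLE STEP OF THE REALISED CONSTRUCTION** (the hypotheses of
`ReachD.step` with direction space `{S}'`, modulus `σ ≤ τ/4`, ratio `β`): `(εθ)_n > 0`; `V_{n+1} = W_n(1 + N_n)` with
`N_n ∈ {S}'`, `‖N_n‖ ≤ 2β/σ`; `(εθ)_{n+1} = (1−β)(εθ)_n` EXACTLY; `|Re⟨x₀, v_{n+1} − v_n⟩| ≤ (22/σ)β(εθ)_n`;
`|ε_{n+1}² − ε_n²| ≤ (22/σ + 1)β(εθ)_n`. [cite: Enflo2023, v2 (41)–(46) p.18–19, (b′) p.17] -/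
theorem fK_step {σ : ℝ} (hσ : 0 < σ) (hσ1 : σ ≤ 1) (hστ : σ ≤ τ / 4) (n : ℕ) :
    0 < (fK hτ hτ1 hβ0 hβ1 n).etheta ∧
    (∃ p : Comm (S : ℓ2 →L[ℂ] ℓ2), ‖p‖ ≤ 2 * β / σ ∧
      (fK hτ hτ1 hβ0 hβ1 (n + 1)).V = Wn (fK hτ hτ1 hβ0 hβ1 n) ∘L (1 + ιS S p)) ∧
    (fK hτ hτ1 hβ0 hβ1 (n + 1)).etheta = (1 - β) * (fK hτ hτ1 hβ0 hβ1 n).etheta ∧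
    |(⟪xD, (fK hτ hτ1 hβ0 hβ1 (n + 1)).v - (fK hτ hτ1 hβ0 hβ1 n).v⟫_ℂ).re| ≤
      22 / σ * β * (fK hτ hτ1 hβ0 hβ1 n).etheta ∧
    |(fK hτ hτ1 hβ0 hβ1 (n + 1)).ε ^ 2 - (fK hτ hτ1 hβ0 hβ1 n).ε ^ 2| ≤
      (22 / σ + 1) * β * (fK hτ hτ1 hβ0 hβ1 n).etheta := by
  have hs0 := sK_nonneg hτ (by linarith : τ ≤ 1 / 2) (κseq τ β n)
  obtain ⟨ht0, ht1, hg⟩ := tR_spec hβ0 (by linarith : β < 1) hs0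
  have hκ := κseq_pos hτ hτ1 hβ0 hβ1 n
  have hsβ := sK_κseq_le_β hτ hτ1 hβ0 hβ1 n
  have hs1 : sK τ (κseq τ β n) ≤ 1 := hsβ.trans (by linarith)
  have hs1' : sK τ (tR β (sK τ (κseq τ β n)) * κseq τ β n) ≤ 1 := by
    rw [← κseq_succ]; exact (sK_κseq_le_β hτ hτ1 hβ0 hβ1 (n + 1)).trans (by linarith)
  exact ⟨stK_etheta_pos hτ hτ1 hκ _, step_V hτ hτ1 hβ0 hβ1 hκ hsβ ht0 ht1 hg hs1 hs1' hσ hστ,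
    step_ratio hτ hτ1 hβ0 hβ1 hκ hsβ ht0 ht1 hg hs1 hs1', step_drift_v hτ hτ1 hβ0 hβ1 hκ hsβ ht0 ht1 hg hs1 hs1' hσ hσ1,
    step_drift_ε hτ hτ1 hβ0 hβ1 hκ hsβ ht0 ht1 hg hs1 hs1' hσ hσ1⟩

/-- the run is scheduled: `(εθ)_n = (1−β)ⁿ(εθ)₀`. [cite: Enflo2023, v2 (b′) p.17, (45) p.19] -/
lemma fK_etheta {σ : ℝ} (hσ : 0 < σ) (hσ1 : σ ≤ 1) (hστ : σ ≤ τ / 4) :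
    ∀ n, (fK hτ hτ1 hβ0 hβ1 n).etheta = (1 - β) ^ n * (fK hτ hτ1 hβ0 hβ1 0).etheta
  | 0 => by rw [pow_zero, one_mul]
  | n + 1 => by
    obtain ⟨-, -, h, -, -⟩ := fK_step hτ hτ1 hβ0 hβ1 hσ hσ1 hστ n
    rw [h, fK_etheta hσ hσ1 hστ n, pow_succ]; ring

/-- **THE RUN IS AN ORBIT OF THE REALISED CONSTRUCTION** (`σ ≤ τ/4`): every `s_n` is reached from `s₀` by `n`
admissible steps. [cite: Enflo2023, v2 (41)–(46) p.18–19] -/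
theorem fK_reachD {σ : ℝ} (hσ : 0 < σ) (hσ1 : σ ≤ 1) (hστ : σ ≤ τ / 4) :
    ∀ n, ReachD (ιS S) σ β (fK hτ hτ1 hβ0 hβ1 0) (fK hτ hτ1 hβ0 hβ1 n)
  | 0 => ReachD.start
  | n + 1 => by
    obtain ⟨he, hp, hr, hd1, hd2⟩ := fK_step hτ hτ1 hβ0 hβ1 hσ hσ1 hστ n
    exact ReachD.step (fK_reachD hσ hσ1 hστ n) he hp hr hd1 hd2

/-- THE MOVED PARTS CONVERGE TO A NON-CYCLIC VECTOR: `x₀ − v_n = V_nℓ'_n → (4/5)u₀`, an eigenvector of `T_τ`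
(`TD_u_zero`) — the text's endgame (p.19 l.677–683) realised in the model. [cite: Enflo2023, v2 p.19 l.677–683] -/
theorem fK_tendsto :
    Tendsto (fun n => xD - (fK hτ hτ1 hβ0 hβ1 n).v) atTop (𝓝 (((4 / 5 : ℝ) : ℂ) • u 0)) := by
  have hs : Tendsto (fun n => sK τ (κseq τ β n)) atTop (𝓝 0) := by
    have h1 : Tendsto (fun n : ℕ => (1 - β) ^ n * β) atTop (𝓝 (0 * β)) :=
      (tendsto_pow_atTop_nhds_zero_of_lt_one (by linarith) (by linarith)).mul_const β
    rw [zero_mul] at h1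
    exact tendsto_of_tendsto_of_tendsto_of_le_of_le tendsto_const_nhds h1
      (fun n => sK_nonneg hτ (by linarith) _) (fun n => sK_κseq_le hτ hτ1 hβ0 hβ1 n)
  have hζ : Tendsto (fun n => ζK τ (κseq τ β n)) atTop (𝓝 (3 / 5)) := by
    have h := (tendsto_const_nhds : Tendsto (fun _ : ℕ => (3 / 5 : ℝ)) atTop (𝓝 (3 / 5))).div
      (tendsto_const_nhds.add hs) (by norm_num : (1 : ℝ) + 0 ≠ 0)
    rw [add_zero, div_one] at h
    exact h
  have hz : Tendsto (fun n => ((ζK τ (κseq τ β n) : ℝ) : ℂ) • u 1) atTop (𝓝 (((3 / 5 : ℝ) : ℂ) • u 1)) :=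
    ((Complex.continuous_ofReal.tendsto _).comp hζ).smul_const _
  have hv : (fun n => xD - (fK hτ hτ1 hβ0 hβ1 n).v) = fun n => xD - ((ζK τ (κseq τ β n) : ℝ) : ℂ) • u 1 := by
    funext n
    rw [fK, stK_v hτ hτ1 (κseq_pos hτ hτ1 hβ0 hβ1 n)]; rfl
  have hlim : xD - ((3 / 5 : ℝ) : ℂ) • u 1 = ((4 / 5 : ℝ) : ℂ) • u 0 := by rw [xD, add_sub_cancel_right]
  rw [hv, ← hlim]
  exact tendsto_const_nhds.sub hz

/-- **THE ORBIT TREE IS INFINITE AT SMALL MODULUS.**  For `T_τ = diag(τ, τ/2)` (`0 < τ ≤ 1/100`), modulus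
`0 < σ ≤ τ/4` and ratio `0 < β ≤ σ²/1000`, at the admissible cyclic start `x₀ = (4/5, 3/5)`, `y₀ = (M(κ₀), κ₀)`
(`s(κ₀) = β`: a true MC state with `(εθ)₀ > 0`, the start margin of the run, both eigen-coordinates non-zero)
there IS a scheduled run of the realised Main Construction "to arbitrarily small `(εθ)`'s": states `s_n`, each
reached from `s₀` by `n` admissible steps (`ReachD (ιS S) σ β`), with `(εθ)_{s_n} = (1−β)ⁿ(εθ)₀`, whose moved parts
`x₀ − v_n` converge to the non-cyclic vector `(4/5)u₀`.  This is the NEGATION of the conclusion of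
`DiagN.no_scheduled_run` (which needs `τ ≤ σ/100`) in the complementary regime `σ ≤ τ/4` — the regime containing the
model's own type-1 constant `δ₂ = (τ/2)²` (`exists_scheduled_run_at_type1Const`). [cite: Enflo2023, v2 (45)–(46) p.19, p.19 l.656–683] -/
theorem exists_scheduled_run {σ : ℝ} (hσ : 0 < σ) (hστ : σ ≤ τ / 4) (hβ : β ≤ σ ^ 2 / 1000) :
    ∃ s₀ : State (TD τ) xD S, 0 < s₀.etheta ∧
      ((0.09 : ℝ) + (22 / σ + 1) * s₀.etheta ≤ s₀.ε ^ 2 ∧ s₀.ε ^ 2 + (22 / σ + 1) * s₀.etheta ≤ 0.49) ∧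
      (∀ i, cf s₀.V i ≠ 0) ∧
      ∃ f : ℕ → State (TD τ) xD S, f 0 = s₀ ∧ (∀ n, ReachD (ιS S) σ β s₀ (f n)) ∧
        (∀ n, (f n).etheta = (1 - β) ^ n * s₀.etheta) ∧
        Tendsto (fun n => xD - (f n).v) atTop (𝓝 (((4 / 5 : ℝ) : ℂ) • u 0)) := by
  have hσ1 : σ ≤ 1 := by linarith
  have hκ0 := κseq_pos hτ hτ1 hβ0 hβ1 0
  have hs0 : sK τ (κseq τ β 0) = β := sK_κseq_zero hτ (by linarith) hβ0.le
  have he : (fK hτ hτ1 hβ0 hβ1 0).etheta = ζK τ (κseq τ β 0) ^ 2 * β := by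
    rw [fK, stK_etheta, hs0]
  have hε : (fK hτ hτ1 hβ0 hβ1 0).ε = ζK τ (κseq τ β 0) := stK_ε hτ hτ1 hκ0 _
  have hζ : ζK τ (κseq τ β 0) * (1 + β) = 3 / 5 := by
    rw [ζK, hs0]; exact div_mul_cancel₀ _ (by positivity)
  refine ⟨fK hτ hτ1 hβ0 hβ1 0, stK_etheta_pos hτ hτ1 hκ0 _, ?_, cf_stK_ne hτ hτ1 hκ0 _, fK hτ hτ1 hβ0 hβ1, rfl,
    fK_reachD hτ hτ1 hβ0 hβ1 hσ hσ1 hστ, fK_etheta hτ hτ1 hβ0 hβ1 hσ hσ1 hστ, fK_tendsto hτ hτ1 hβ0 hβ1⟩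
  rw [he, hε]
  exact start_arith hσ hσ1 hβ0 hβ (hζ) (family_pos hτ (by linarith) hκ0).2.1

omit hβ1 in
/-- **AT THE TEXT'S MODULUS.**  With `σ := δ₂ = (τ/2)²` — the model's own type-1 constant at `j₂ = 2`
(`Diag.type1`: `|⟨T_τ²y, y⟩| ≥ (τ/2)²‖y‖²` for every `y`) — and any ratio `0 < β ≤ δ₂²/1000`, the orbit tree from an
admissible cyclic start is infinite. [cite: Enflo2023, v2 p.6 (type 1), p.19 l.656–677] -/
theorem exists_scheduled_run_at_type1Const (hβ : β ≤ ((τ / 2) ^ 2) ^ 2 / 1000) :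
    ∃ s₀ : State (TD τ) xD S, 0 < s₀.etheta ∧
      ((0.09 : ℝ) + (22 / (τ / 2) ^ 2 + 1) * s₀.etheta ≤ s₀.ε ^ 2 ∧
        s₀.ε ^ 2 + (22 / (τ / 2) ^ 2 + 1) * s₀.etheta ≤ 0.49) ∧
      (∀ i, cf s₀.V i ≠ 0) ∧
      ∃ f : ℕ → State (TD τ) xD S, f 0 = s₀ ∧ (∀ n, ReachD (ιS S) ((τ / 2) ^ 2) β s₀ (f n)) ∧
        (∀ n, (f n).etheta = (1 - β) ^ n * s₀.etheta) ∧
        Tendsto (fun n => xD - (f n).v) atTop (𝓝 (((4 / 5 : ℝ) : ℂ) • u 0)) := by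
  have h4 : ((τ / 2) ^ 2) ^ 2 ≤ 1 := pow_le_one₀ (sq_nonneg _) (by nlinarith)
  have hβ1 : β ≤ 1 / 1000 := hβ.trans (div_le_div_of_nonneg_right h4 (by norm_num))
  exact exists_scheduled_run hτ hτ1 hβ0 hβ1 (by positivity) (by nlinarith) hβ

end run

end Diag

namespace DiagN

/-- **The complement of `no_scheduled_run` (`d = 2`, `w = (τ, τ/2)`), in its own types.**  For `0 < τ ≤ 1/100`,
`0 < σ ≤ τ/4`, `0 < β ≤ σ²/1000` there are a unit `x₀ ∈ ℂ²` and a true MC start `s₀` over the shift with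
`(εθ)₀ > 0`, the start margin and all eigen-coefficients non-zero, FROM WHICH a scheduled run
`(εθ)_{s_n} = (1−β)ⁿ(εθ)₀` through the orbit tree `ReachD (ιS S) σ β s₀` exists — so the hypothesis `τ ≤ σ/100` of
`no_scheduled_run` / `reachD_etheta_floor` / `indepRunD_etheta_eq_zero` cannot be weakened to cover `σ ≤ τ/4`.
[cite: Enflo2023, v2 (45) p.19; p.19 l.656–677] -/
theorem exists_scheduled_run_two {τ σ β : ℝ} (hτ : 0 < τ) (hτ1 : τ ≤ 1 / 100) (hσ : 0 < σ) (hστ : σ ≤ τ / 4)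
    (hβ0 : 0 < β) (hβ : β ≤ σ ^ 2 / 1000) :
    ∃ (x₀ : Cd 2) (s₀ : State (TDg (Diag.wt τ)) x₀ S), ‖x₀‖ = 1 ∧ 0 < s₀.etheta ∧
      ((0.09 : ℝ) + (22 / σ + 1) * s₀.etheta ≤ s₀.ε ^ 2 ∧ s₀.ε ^ 2 + (22 / σ + 1) * s₀.etheta ≤ 0.49) ∧
      (∀ i, cf s₀.V i ≠ 0) ∧
      ∃ f : ℕ → State (TDg (Diag.wt τ)) x₀ S,
        (∀ n, ReachD (ιS S) σ β s₀ (f n)) ∧ ∀ n, (f n).etheta = (1 - β) ^ n * s₀.etheta := by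
  rw [TDg_wt]
  have hσ2 : σ ^ 2 ≤ 1 := by nlinarith
  have hβ1 : β ≤ 1 / 1000 := hβ.trans (div_le_div_of_nonneg_right hσ2 (by norm_num))
  obtain ⟨s₀, he, hm, hc, f, -, hf, hfe, -⟩ := Diag.exists_scheduled_run hτ hτ1 hβ0 hβ1 hσ hστ hβ
  have hc' : ∀ i, cf s₀.V i ≠ 0 := Fin.forall_fin_two.2 ⟨hc 0, hc 1⟩
  exact ⟨Diag.xD, s₀, Diag.norm_xD, he, hm, hc', f, hf, hfe⟩

end DiagN

end StepRealisation

end Literature.Analysis.OperatorTheory.Enflo2023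

end
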